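import Literature.Algebra.Polynomial.CasasAlvero.BadDegrees
import Literature.Algebra.Polynomial.CasasAlvero.SmallDegreesSummary
import Mathlib.Data.Nat.Choose.Lucas
import Mathlib.Data.Nat.Log
import HarnessLib

/-!
# The base-`p` digit criterion and complete classifications in characteristics 2, 3, 5, 7

**Binomial counterexamples.** If `0 < m < d` and `binom(d, m) = 1` in `K`, then `X^d - X^m` is a monic Casas-Alvero
polynomial of degree `d` over `K` (witness root `1` for the `m`-th Hasse derivative, `0` for all others) which is not a
pure `d`-th power; hence `¬ CA_d(K)`.  By Lucas' theorem `binom(a·p^k + r, r) ≡ 1 (mod p)` whenever `r < p^k`, so: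

**Digit criterion.** Over a field of characteristic `p`, `CA_d(K)` can only hold when `d = a·p^k` with a single
non-zero base-`p` digit `1 ≤ a ≤ p - 1` (`not_holdsInDegree_of_not_digit`); in particular `¬ CA_d` for every `d ≥ 2`
with `d ≡ 1 (mod p)` (this contains the classical examples `X^{p^k+1} - X^{p^k}` of [GrafVonBothmerEtAl2007]).

Combined with `CA_{p^k}`, `CA_{2p^k}`, `CA_{3p^k}` (`p ≥ 5`) [GrafVonBothmerEtAl2007, Props. 2, 6] and the refutations of
`CA_4` (`p = 3, 5, 7`), `CA_5`, `CA_6` (`p = 7`) in this directory, this yields the COMPLETE list of Casas-Alvero degrees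
over every field of characteristic 2, 3, 5 or 7:
`{0} ∪ {2^k}`, `{0} ∪ {3^k, 2·3^k}`, `{0} ∪ {5^k, 2·5^k, 3·5^k}`, `{0} ∪ {7^k, 2·7^k, 3·7^k}`.
-/

noncomputable section

open Polynomial

namespace Literature.Algebra.Polynomial.CasasAlvero

section Binomial

variable {K : Type*} [Field K]

/-- degree of `X^d - X^m` (`m < d`). [folklore] -/
theorem natDegree_X_pow_sub_X_pow {d m : ℕ} (hmd : m < d) : ((X : K[X]) ^ d - X ^ m).natDegree = d := by
  rw [natDegree_sub_eq_left_of_natDegree_lt (by rw [natDegree_X_pow, natDegree_X_pow]; exact hmd), natDegree_X_pow]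

/-- `X^d - X^m` is monic (`m < d`). [folklore] -/
theorem monic_X_pow_sub_X_pow {d m : ℕ} (hmd : m < d) : ((X : K[X]) ^ d - X ^ m).Monic :=
  (monic_X_pow d).sub_of_left (by rw [degree_X_pow, degree_X_pow]; exact_mod_cast hmd)

/-- **binomial Casas-Alvero polynomials**: if `0 < m < d` and `binom(d,m) = 1` in `K` then `X^d - X^m` is Casas-Alvero
(the `m`-th Hasse derivative `binom(d,m) X^(d-m) - 1` vanishes at the root `1`, every other one at the root `0`). [folklore] -/
theorem isCasasAlvero_X_pow_sub_X_pow {d m : ℕ} (hm0 : 0 < m) (hmd : m < d) (h1 : ((d.choose m : ℕ) : K) = 1) :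
    IsCasasAlvero ((X : K[X]) ^ d - X ^ m) := by
  intro i hi0 hi
  rw [natDegree_X_pow_sub_X_pow hmd] at hi
  rw [map_sub, hasseDeriv_X_pow, hasseDeriv_X_pow]
  by_cases him : i = m
  · subst him
    exact ⟨1, by simp, by simp [h1]⟩
  · have hdi : d - i ≠ 0 := by omega
    refine ⟨0, by simp [zero_pow (by omega : d ≠ 0), zero_pow (by omega : m ≠ 0)], ?_⟩
    rcases lt_or_gt_of_ne him with hlt | hgt
    · have hmi : m - i ≠ 0 := by omega
      simp [zero_pow hdi, zero_pow hmi]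
    · simp [zero_pow hdi, Nat.choose_eq_zero_of_lt hgt]

/-- `X^d - X^m` (`0 < m < d`) is not a pure `d`-th power. [folklore] -/
theorem X_pow_sub_X_pow_ne_pow {d m : ℕ} (hm0 : 0 < m) (hmd : m < d) (a : K) :
    (X : K[X]) ^ d - X ^ m ≠ (X - C a) ^ d := by
  intro h
  have h0 := congrArg (eval 0) h
  simp only [eval_sub, eval_pow, eval_X, eval_C, zero_pow (by omega : d ≠ 0), zero_pow (by omega : m ≠ 0),
    sub_zero, zero_sub] at h0
  have ha : a = 0 := by
    have := (pow_eq_zero_iff (by omega : d ≠ 0)).mp h0.symm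
    exact neg_eq_zero.mp this
  subst ha
  rw [map_zero, sub_zero] at h
  simp at h

/-- hence `binom(d,m) = 1` in `K` for some `0 < m < d` refutes `CA_d(K)`. [folklore] -/
theorem not_holdsInDegree_of_cast_choose_eq_one {d m : ℕ} (hm0 : 0 < m) (hmd : m < d)
    (h1 : ((d.choose m : ℕ) : K) = 1) : ¬ HoldsInDegree K d := by
  intro h
  obtain ⟨a, ha⟩ := h _ (monic_X_pow_sub_X_pow hmd) (natDegree_X_pow_sub_X_pow hmd)
    (isCasasAlvero_X_pow_sub_X_pow hm0 hmd h1)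
  exact X_pow_sub_X_pow_ne_pow hm0 hmd a ha

end Binomial

variable (K : Type*) [Field K] (p : ℕ) [Fact p.Prime] [CharP K p]

omit [Fact p.Prime] in
/-- `binom(d,m) ≡ 1 (mod p)` for some `0 < m < d` refutes `CA_d` in characteristic `p`. [folklore] -/
theorem not_holdsInDegree_of_choose_modEq_one {d m : ℕ} (hm0 : 0 < m) (hmd : m < d)
    (h1 : d.choose m ≡ 1 [MOD p]) : ¬ HoldsInDegree K d :=
  not_holdsInDegree_of_cast_choose_eq_one (K := K) hm0 hmd
    (by have := (CharP.natCast_eq_natCast K p).mpr h1; simpa using this)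

omit [Fact p.Prime] in
/-- every degree `d ≥ 2` with `d ≡ 1 (mod p)` is a non-Casas-Alvero degree in characteristic `p`
(`X^d - X^(d-1)`; contains `d = p^k + 1` of [cite: GrafVonBothmerEtAl2007, Example after Prop. 6]). -/
theorem not_holdsInDegree_of_modEq_one {d : ℕ} (hd : 2 ≤ d) (h1 : d ≡ 1 [MOD p]) : ¬ HoldsInDegree K d :=
  not_holdsInDegree_of_choose_modEq_one K p (m := d - 1) (by omega) (by omega)
    (by rw [Nat.choose_symm (by omega : 1 ≤ d), Nat.choose_one_right]; exact h1)

omit [CharP K p] in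
/-- Lucas: `binom(a·p^k + r, r) ≡ 1 (mod p)` for `r < p^k`. [folklore] -/
theorem choose_mul_pow_add_modEq_one (a : ℕ) : ∀ (k r : ℕ), r < p ^ k → (a * p ^ k + r).choose r ≡ 1 [MOD p]
  | 0, r, hr => by
      have hr0 : r = 0 := by simpa using hr
      subst hr0; simp [Nat.ModEq]
  | k + 1, r, hr => by
      have hp : 0 < p := (Fact.out : p.Prime).pos
      have h := Choose.choose_modEq_choose_mod_mul_choose_div_nat (n := a * p ^ (k + 1) + r) (k := r) (p := p)
      have hn1 : (a * p ^ (k + 1) + r) % p = r % p := by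
        rw [pow_succ, ← mul_assoc, mul_comm (a * p ^ k) p, Nat.mul_add_mod]
      have hn2 : (a * p ^ (k + 1) + r) / p = a * p ^ k + r / p := by
        rw [pow_succ, ← mul_assoc, mul_comm (a * p ^ k) p, Nat.mul_add_div hp]
      have hr' : r / p < p ^ k := by
        rw [Nat.div_lt_iff_lt_mul hp]; rwa [pow_succ] at hr
      rw [hn1, hn2, Nat.choose_self, one_mul] at h
      exact h.trans (choose_mul_pow_add_modEq_one a k (r / p) hr')

/-- **two non-zero base-`p` digit blocks refute CA**: `¬ CA_{a·p^k + r}` for `a ≥ 1`, `1 ≤ r < p^k`. [folklore] -/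
theorem not_holdsInDegree_mul_pow_add {k a r : ℕ} (ha : 0 < a) (hr0 : 0 < r) (hr : r < p ^ k) :
    ¬ HoldsInDegree K (a * p ^ k + r) := by
  have hp : 0 < p := (Fact.out : p.Prime).pos
  have hak : 0 < a * p ^ k := Nat.mul_pos ha (pow_pos hp k)
  exact not_holdsInDegree_of_choose_modEq_one K p hr0 (by omega) (choose_mul_pow_add_modEq_one p a k r hr)

/-- **digit criterion**: in characteristic `p`, `CA_d(K)` forces `d = a·p^k` with a single non-zero base-`p` digit
`a ≤ p - 1` (or `d = 0`). [folklore] -/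
theorem not_holdsInDegree_of_not_digit {d : ℕ} (hd : d ≠ 0) (h : ∀ k a : ℕ, a < p → d ≠ a * p ^ k) :
    ¬ HoldsInDegree K d := by
  have hp1 : 1 < p := (Fact.out : p.Prime).one_lt
  have h1 : p ^ Nat.log p d ≤ d := Nat.pow_log_le_self p hd
  have h2 : d < p ^ (Nat.log p d + 1) := Nat.lt_pow_succ_log_self hp1 d
  have hpk : 0 < p ^ Nat.log p d := pow_pos (by omega) _
  have ha : 0 < d / p ^ Nat.log p d := Nat.div_pos h1 hpk
  have hap : d / p ^ Nat.log p d < p := by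
    rw [Nat.div_lt_iff_lt_mul hpk, mul_comm]; rwa [pow_succ] at h2
  have e := Nat.div_add_mod' d (p ^ Nat.log p d)
  have hr : 0 < d % p ^ Nat.log p d := by
    refine Nat.pos_of_ne_zero (fun h0 => h (Nat.log p d) (d / p ^ Nat.log p d) hap ?_)
    rw [h0, add_zero] at e
    exact e.symm
  have := not_holdsInDegree_mul_pow_add K p (k := Nat.log p d) ha hr (Nat.mod_lt d hpk)
  rwa [e] at this

/-- the possible Casas-Alvero degrees in characteristic `p`, positively phrased. [folklore] -/
theorem exists_eq_digit_of_holdsInDegree {d : ℕ} (hd : d ≠ 0) (h : HoldsInDegree K d) :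
    ∃ k a : ℕ, 0 < a ∧ a < p ∧ d = a * p ^ k := by
  by_contra hne
  push Not at hne
  refine not_holdsInDegree_of_not_digit K p hd (fun k a ha hda => ?_) h
  rcases Nat.eq_zero_or_pos a with rfl | ha0
  · exact hd (by simpa using hda)
  · exact hne k a ha0 ha hda

section Classification

variable (K : Type*) [Field K]

/-- **characteristic 2**: `CA_d(K) ⟺ d = 0 ∨ d = 2^k`. [cite: GrafVonBothmerEtAl2007, Prop. 2] -/
theorem classification_char_two [CharP K 2] (d : ℕ) : HoldsInDegree K d ↔ d = 0 ∨ ∃ k, d = 2 ^ k := by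
  constructor
  · intro h
    by_contra hne
    push Not at hne
    obtain ⟨hd0, hne⟩ := hne
    refine not_holdsInDegree_of_not_digit K 2 hd0 (fun k a ha => ?_) h
    interval_cases a
    · simpa using hd0
    · simpa using hne k
  · rintro (rfl | ⟨k, rfl⟩)
    · exact holdsInDegree_zero K
    · exact holdsInDegree_prime_pow_field K 2 k

/-- **characteristic 3**: `CA_d(K) ⟺ d = 0 ∨ d = 3^k ∨ d = 2·3^k`. [cite: GrafVonBothmerEtAl2007, Props. 2, 6] -/
theorem classification_char_three [CharP K 3] (d : ℕ) :
    HoldsInDegree K d ↔ d = 0 ∨ ∃ k, d = 3 ^ k ∨ d = 2 * 3 ^ k := by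
  constructor
  · intro h
    by_contra hne
    push Not at hne
    obtain ⟨hd0, hne⟩ := hne
    refine not_holdsInDegree_of_not_digit K 3 hd0 (fun k a ha => ?_) h
    obtain ⟨h1, h2⟩ := hne k
    interval_cases a
    · simpa using hd0
    · simpa using h1
    · exact h2
  · rintro (rfl | ⟨k, rfl | rfl⟩)
    · exact holdsInDegree_zero K
    · exact holdsInDegree_prime_pow_field K 3 k
    · exact holdsInDegree_two_mul_prime_pow_field K 3 k

/-- **characteristic 5**: `CA_d(K) ⟺ d = 0 ∨ d ∈ {5^k, 2·5^k, 3·5^k}` (`CA_{4·5^k}` fails).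
[cite: GrafVonBothmerEtAl2007, Props. 2, 6, 7] -/
theorem classification_char_five [CharP K 5] (d : ℕ) :
    HoldsInDegree K d ↔ d = 0 ∨ ∃ k, d = 5 ^ k ∨ d = 2 * 5 ^ k ∨ d = 3 * 5 ^ k := by
  haveI : Fact (Nat.Prime 5) := ⟨by norm_num⟩
  constructor
  · intro h
    by_contra hne
    push Not at hne
    obtain ⟨hd0, hne⟩ := hne
    by_cases h4 : ∃ k, d = 4 * 5 ^ k
    · obtain ⟨k, rfl⟩ := h4
      exact not_holdsInDegree_four_mul_prime_pow 5 (by norm_num) k h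
    · push Not at h4
      refine not_holdsInDegree_of_not_digit K 5 hd0 (fun k a ha => ?_) h
      obtain ⟨h1, h2, h3⟩ := hne k
      interval_cases a
      · simpa using hd0
      · simpa using h1
      · exact h2
      · exact h3
      · exact h4 k
  · rintro (rfl | ⟨k, rfl | rfl | rfl⟩)
    · exact holdsInDegree_zero K
    · exact holdsInDegree_prime_pow_field K 5 k
    · exact holdsInDegree_two_mul_prime_pow_field K 5 k
    · exact holdsInDegree_three_mul_prime_pow_field K 5 (by norm_num) k

/-- **characteristic 7**: `CA_d(K) ⟺ d = 0 ∨ d ∈ {7^k, 2·7^k, 3·7^k}` (`CA_{4·7^k}, CA_{5·7^k}, CA_{6·7^k}` fail).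
[cite: GrafVonBothmerEtAl2007, Props. 2, 6, 7] [cite: CastryckLaterveerOunaies2012, §2] -/
theorem classification_char_seven [CharP K 7] (d : ℕ) :
    HoldsInDegree K d ↔ d = 0 ∨ ∃ k, d = 7 ^ k ∨ d = 2 * 7 ^ k ∨ d = 3 * 7 ^ k := by
  haveI : Fact (Nat.Prime 7) := ⟨by norm_num⟩
  constructor
  · intro h
    by_contra hne
    push Not at hne
    obtain ⟨hd0, hne⟩ := hne
    by_cases h4 : ∃ k, d = 4 * 7 ^ k
    · obtain ⟨k, rfl⟩ := h4
      exact not_holdsInDegree_four_mul_prime_pow 7 (by norm_num) k h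
    by_cases h5 : ∃ k, d = 5 * 7 ^ k
    · obtain ⟨k, rfl⟩ := h5
      exact not_holdsInDegree_five_mul_prime_pow K 7 (by norm_num) k h
    by_cases h6 : ∃ k, d = 6 * 7 ^ k
    · obtain ⟨k, rfl⟩ := h6
      exact not_holdsInDegree_six_mul_prime_pow K 7 (by norm_num) k h
    push Not at h4 h5 h6
    refine not_holdsInDegree_of_not_digit K 7 hd0 (fun k a ha => ?_) h
    obtain ⟨h1, h2, h3⟩ := hne k
    interval_cases a
    · simpa using hd0
    · simpa using h1
    · exact h2
    · exact h3
    · exact h4 k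
    · exact h5 k
    · exact h6 k
  · rintro (rfl | ⟨k, rfl | rfl | rfl⟩)
    · exact holdsInDegree_zero K
    · exact holdsInDegree_prime_pow_field K 7 k
    · exact holdsInDegree_two_mul_prime_pow_field K 7 k
    · exact holdsInDegree_three_mul_prime_pow_field K 7 (by norm_num) k

end Classification

end Literature.Algebra.Polynomial.CasasAlvero
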